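/-
hodgecm-mathlib (D-0151 release-track, cell HOME run/shared/lean/pub/hodgecm-mathlib/) — row «NONVAC-III (BINDER TAILS)», seat B-p18 (g23)
(prover-hodgecm-mathlib-B-p18-g23-0), 2026-08-31.  THEOREMS ONLY (proof lane): no `def`, no `instance`, no notation, no `sorry`; nothing landed is
edited or restated.  FRAMING: HC_CM is proved only modulo the printed citations until rung 0 closes; this file asserts no citation and moves no count —
it records that the ∀-telescopes of the remaining printed-citation binders range over INHABITED domains.
-/
import Summits.HodgeConjecture.CorCM.D2Bridge.PrintedCitationHypothesesT
import Summits.HodgeConjecture.CorCM.D2Bridge.IndexInhabited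
import Summits.HodgeConjecture.HodgeCM.Model.LiuIndexMuLiuOrient
import Summits.HodgeConjecture.HodgeConjecture.Theorems.HCCMUnconditionalHDelOfF0
import Literature.NumberTheory.Automorphic.Liu2021.Thm418Invariants
import HarnessLib

/-!
# Non-vacuity of the printed-citation binders of `hc_cm_of_printed_citations_muKey_ident_lemD3_delRecConjOmegaT`: the binder TAILS

The headline theorem `Summit.HodgeConjecture.CorCM.D2Bridge.MuKeyIdentLemD3DelRecConjOmegaEndT.hc_cm_of_printed_citations_muKey_ident_lemD3_delRecConjOmegaT`
(`CorCM/D2Bridge/ClosedPrintedMuKeyIdentLemD3DelRecConjOmegaT.lean` :103–186) displays seven hypotheses; five of them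
(`PrintedCitationHypotheses.HypLiu418 ∕ Hyp413 ∕ Hyp411 ∕ HypD3 ∕ HypD1pp`) are ∀-statements over a common HEAD
`(hDel) (F : HodgeCM.CMField) [IsGalois ℚ F] (h6 : 6 ≤ finrank ℚ F) {ι₁ : F →+* ℂ} (V : HodgeCM.HermSpace3 F ι₁)` followed by row-specific TAILS:

* `HypLiu418`: `(a : RealScalar F) (Φ : CMType F) (hΦ : ι₁ ∈ Φ.1) (ν) (hν : IsConjugateSymplectic F ν) (hw : HasWeight F ν 1) (R') (hR') (Φ')`;
* `Hyp413`:   `(a₀ : RealScalar F) (Φ) (hΦ) (i : I V (repAt a₀) (muLiu ι₁ GramClass.rep))`;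
* `Hyp411`:   `(a) (Φ) (hΦ) (μ) (hμ) (hw)`;   `HypD3`: `(a) (Φ) (hΦ) (v : HeightOneSpectrum (𝓞 F⁺))` (and, inside, the index `Σ μw, AdmIndex`);
* `HypD1pp`:  `(a) (Φ) (hΦ) (μ) (hμ) (hw) (j : (toThm418Data _ (restOfCharDeltaPrime hDel …) μ hμ hw).AdmIndex) (v)`.

A proof of a ∀-statement over an EMPTY domain is contentless, so the closure audits of items 24832 (`HLiu418`) and 24833 (`H413`)
ask for an inhabitation witness of every structure quantified over (cell bus, director s451 (c) ∕ s459).  The HEAD is witnessed by the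
companion rows NONVAC-V₂ (★ p810343, non-Galois `K₂`) and NONVAC-II (Galois cyclotomic datum, B-p02 (g19)).  THIS FILE witnesses the TAILS
over an ARBITRARY head — so that together with any head witness the full telescope is inhabited — using tree theorems only:

* `hDel` itself: ★ `Summit.HodgeConjecture.HodgeConjecture.Theorems.HCCMUnconditionalHDelOfF0.HDel_holds` (item 24835, Mathlib-only, audited);
* `a : RealScalar F`: the scalar `1` (`LiuIndexPin` §1);  `Φ ∋ ι₁`: the sign-recipe type `Φ^δ(±1)` (`SignRecipe.lineType`, `LiuIndex.mem_lineType_iff_mul_pos`);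
* `ν` conjugate-symplectic OF WEIGHT ONE: ★ `IdeleClassGroup.exists_isConjugateSymplectic_hasCMType` ([WeilBNT1967] Ch. VII §3; `ConjugateSelfDualCharacters` :554);
* `(R', hR')`: ★ R6 `D2Bridge.MuConjIdent.exists_recordSystemConj_X_sec42DataOf_levelOf_eq` — the very `obtain` of the headline's proof (:166);
* `i`: ★ `D2Bridge.IndexInhabited.nonempty_index` under E's orientation `hemb : (InfinitePlace.mk ι₁).embedding = ι₁` (always satisfiable:
  `exists_embedding_mk_embedding_eq`; at `conj ∘ ι₁` the index is empty by the catalogued orientation obstruction, so `hemb` is the right side condition);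
* `j` and the `HypD3` index: ★ `Liu2021.Thm418Data.nonempty_admIndex` ([Liu2021] Def. 4.12, admissible elements by weak approximation);
* `v`: `𝓞 F⁺` is not a field (Mathlib `NumberField.RingOfIntegers.not_isField`).

Main heads: `hypLiu418_tail_inhabited`, `hypLiu418_telescope_inhabited_of_head` (the `hDel` binder included, ∃-bound and discharged by `HDel_holds`),
`hyp413_tail_inhabited`, `hyp411_tail_inhabited`, `hypD1pp_index_inhabited`, `hypD3_index_inhabited`, `nonempty_heightOneSpectrum_maximalRealSubfield`,
and the composition `hccm_binders_inhabited_at (F) [IsGalois ℚ F] (h6) (V) (hemb)` (§6, director s460 (iii)).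
The binder types are pasted token-for-token from `PrintedCitationHypothesesT.lean` (same namespace and `open`s), with `hDel` a variable.
HC_CM is NOT proved unconditionally by anything here.
-/

set_option autoImplicit false

noncomputable section

namespace Summit.HodgeConjecture.CorCM.D2Bridge.MuKeyIdentLemD3DelRecConjOmegaEndT

open scoped TensorProduct Matrix
open NumberField NumberField.InfinitePlace
open HodgeCM.Model HodgeCM.Model.LiuIndex HodgeCM.Model.TowerCarrier
open HodgeCM.Literature.Theta.LiuAlbaneseModuleDatum.D2Bridge (HcmPieces)
open Summit.HodgeConjecture.CorCM.Model
open Literature.AlgebraicGeometry.Motives (CMType)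
open Literature.AlgebraicGeometry.HodgeTheory Literature.NumberTheory.Automorphic.PicardCM
open Literature.AlgebraicGeometry.ShimuraVarieties.UnitaryCanonicalModel
open Literature.NumberTheory.ComplexMultiplication
open Literature.NumberTheory.Automorphic
open Literature.NumberTheory.Automorphic.IdeleClassGroup (toHeckeCharacter isUnitary_toHeckeCharacter galConj)
open Literature.NumberTheory.Automorphic.Liu2021 Literature.NumberTheory.Automorphic.Liu2021.AppendixC
open Literature.NumberTheory.Automorphic.Liu2021.AppendixC.RestOne
open Literature.NumberTheory.Automorphic.Liu2021.Def411WeilCarriers (lineOf locF Rep)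
open Summit.HodgeConjecture.CorCM.Transposition.OmegaTransport (realUnit)
open HodgeCM.Model.ArchSideTerm (e₁)
open Literature.NumberTheory.GelbartRogawski1991 Literature.NumberTheory.GelbartRogawski1991.UnitaryDualPair
open Literature.NumberTheory.GelbartRogawski1991.UnitaryDualPair.LocalSplitting (localMu norm_localMu continuous_localMu localMu_toLocalRing_eq_one_iff
  eq_of_forall_localMu_toHeckeCharacter_eq)
open Literature.RepresentationTheory Literature.RepresentationTheory.Liu2021
open Summit.HodgeConjecture.CorCM.Transposition

namespace NonvacuityBinderTails

/-! ## §1 The elementary tail binders: `a`, `Φ ∋ ι₁`, the orientation `hemb`, the finite place `v` -/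

/-- `RealScalar F` (non-zero `conj`-fixed scalars of the CM field) is inhabited by `1`. [folklore] -/
theorem nonempty_realScalar (F : HodgeCM.CMField) : Nonempty (RealScalar F) :=
  ⟨⟨1, map_one _, one_ne_zero⟩⟩

/-- Every complex embedding `ι₁` of a CM field lies in SOME CM type: `ι₁ ∈ Φ^δ(1)` or `ι₁ ∈ Φ^δ(−1)` according to the sign of
`im ι₁(δ_F)` (`LiuIndex.mem_lineType_iff_mul_pos`: `ι₁ ∈ Φ^δ(a) ↔ 0 < re ι₁(a) · im ι₁(δ_F)`, and `im ι₁(δ_F) ≠ 0`). [folklore] -/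
theorem exists_cmType_mem (F : HodgeCM.CMField) (ι₁ : F →+* ℂ) : ∃ Φ : CMType F, ι₁ ∈ Φ.1 := by
  have hδ : (ι₁ (imagUnit (F : Type))).im ≠ 0 := by
    have h := HodgeCM.SignRecipe.embedding_eta_im_ne_zero (L := F) ι₁
    rwa [HodgeCM.SignRecipe.eta_eq_imagUnit] at h
  rcases lt_or_gt_of_ne hδ with hneg | hpos
  · let a : RealScalar F := ⟨-1, by rw [map_neg, map_one], neg_ne_zero.mpr one_ne_zero⟩
    refine ⟨HodgeCM.SignRecipe.lineType a.1 a.2.1 a.2.2, (mem_lineType_iff_mul_pos a).mpr ?_⟩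
    show 0 < (ι₁ (-1)).re * (ι₁ (imagUnit (F : Type))).im
    rw [map_neg, map_one, Complex.neg_re, Complex.one_re]
    nlinarith
  · let a : RealScalar F := ⟨1, map_one _, one_ne_zero⟩
    refine ⟨HodgeCM.SignRecipe.lineType a.1 a.2.1 a.2.2, (mem_lineType_iff_mul_pos a).mpr ?_⟩
    show 0 < (ι₁ 1).re * (ι₁ (imagUnit (F : Type))).im
    rw [map_one, Complex.one_re, one_mul]
    exact hpos

/-- E's orientation side condition is always satisfiable: some complex embedding IS the distinguished embedding of its place
(`ι₁ := w.embedding` for any infinite place `w`, `InfinitePlace.mk_embedding`). [folklore] -/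
theorem exists_embedding_mk_embedding_eq (F : HodgeCM.CMField) : ∃ ι₁ : F →+* ℂ, (InfinitePlace.mk ι₁).embedding = ι₁ := by
  obtain ⟨w⟩ : Nonempty (InfinitePlace (F : Type)) := inferInstance
  exact ⟨w.embedding, by rw [InfinitePlace.mk_embedding]⟩

/-- The finite places of `F⁺` are a nonempty type: `𝓞 F⁺` is a Dedekind domain which is not a field, so it has a non-zero
maximal ideal. [folklore] -/
theorem nonempty_heightOneSpectrum_maximalRealSubfield (F : HodgeCM.CMField) :
    Nonempty (IsDedekindDomain.HeightOneSpectrum (𝓞 ↥(maximalRealSubfield (F : Type)))) := by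
  obtain ⟨𝔭, h𝔭⟩ := Ideal.exists_maximal (𝓞 ↥(maximalRealSubfield (F : Type)))
  exact ⟨⟨𝔭, h𝔭.isPrime, Ring.ne_bot_of_isMaximal_of_not_isField h𝔭 (RingOfIntegers.not_isField _)⟩⟩

/-! ## §2 The conjugate-symplectic weight-one character `ν` ∕ `μ` -/

/-- **Over every CM field there is a conjugate-symplectic Hecke character OF WEIGHT ONE through any prescribed embedding's CM type**
(the `(ν, hν, hw)` ∕ `(μ, hμ, hw)` tail of `HypLiu418 ∕ Hyp411 ∕ HypD1pp`): by ★ `exists_isConjugateSymplectic_hasCMType`.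
[cite: WeilBNT1967, Ch. VII §3] [cite: Liu2021, Def. 4.1–4.3] -/
theorem exists_tail_character (F : HodgeCM.CMField) (ι₁ : F →+* ℂ) :
    ∃ (Φ : CMType F) (_ : ι₁ ∈ Φ.1) (ν : Literature.NumberTheory.Automorphic.IdeleClassGroup (F : Type) →ₜ* Circle),
      IdeleClassGroup.IsConjugateSymplectic (F : Type) ν ∧ IdeleClassGroup.HasWeight (F : Type) ν 1 ∧
        IdeleClassGroup.HasCMType (F : Type) ν Φ := by
  obtain ⟨Φ, hΦ⟩ := exists_cmType_mem F ι₁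
  obtain ⟨ν, hν, hw, hΦν⟩ := IdeleClassGroup.exists_isConjugateSymplectic_hasCMType (L := (F : Type)) Φ
  exact ⟨Φ, hΦ, ν, hν, hw, hΦν⟩

/-- **The `Hyp411` tail is inhabited** over every head `(F, ι₁)` (its binders after `V` are `(a) (Φ) (hΦ) (μ) (hμ) (hw)`; `V` does not occur in them).
[cite: Liu2021, Def. 4.11 p. 46] [cite: WeilBNT1967, Ch. VII §3] -/
theorem hyp411_tail_inhabited (F : HodgeCM.CMField) (ι₁ : F →+* ℂ) :
    ∃ (_ : RealScalar F) (Φ : CMType F) (_ : ι₁ ∈ Φ.1) (μ : Literature.NumberTheory.Automorphic.IdeleClassGroup (F : Type) →ₜ* Circle)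
      (_ : IdeleClassGroup.IsConjugateSymplectic (F : Type) μ), IdeleClassGroup.HasWeight (F : Type) μ 1 := by
  obtain ⟨Φ, hΦ, μ, hμ, hw, -⟩ := exists_tail_character F ι₁
  exact ⟨⟨1, map_one _, one_ne_zero⟩, Φ, hΦ, μ, hμ, hw⟩

/-! ## §3 The `HypLiu418` tail: the space-identification binder `(R', hR')` -/

/-- **The `HypLiu418` tail is inhabited over every head** `(hDel) (F) (h6) {ι₁} (V)`: there are a line scalar `a`, a CM type `Φ ∋ ι₁`,
a conjugate-symplectic weight-one `ν`, and a conjugate record system `R'` satisfying the space-identification clause `hR'` VERBATIM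
(`[IsGalois ℚ F]` is not used by the tail and is dropped; `Φ'` is witnessed by `Φ`).  Proof = the headline's own
`obtain ⟨R', hR'⟩ := R6` (★ `MuConjIdent.exists_recordSystemConj_X_sec42DataOf_levelOf_eq`) after §2.
[cite: Liu2021, Thm 4.18 p. 52] [cite: WeilBNT1967, Ch. VII §3] -/
theorem hypLiu418_tail_inhabited
    (hDel : Literature.AlgebraicGeometry.ShimuraVarieties.UnitaryCanonicalModel.canonicalModel_exists_printed)
    (F : HodgeCM.CMField) (h6 : 6 ≤ Module.finrank ℚ F) {ι₁ : F →+* ℂ} (V : HodgeCM.HermSpace3 F ι₁) :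
    ∃ (_ : RealScalar F) (Φ : CMType F) (_ : ι₁ ∈ Φ.1) (ν : Literature.NumberTheory.Automorphic.IdeleClassGroup (F : Type) →ₜ* Circle)
      (_ : IdeleClassGroup.IsConjugateSymplectic (F : Type) ν) (_ : IdeleClassGroup.HasWeight (F : Type) ν 1)
      (R' : RecordSystem (HodgeCM.CMField.K F) (Summit.HodgeConjecture.CorCM.Model.RecordSystemConj.conjGram (HodgeCM.CMField.K F) (HodgeCM.HermSpace3.Hm V)) ι₁
        (Summit.HodgeConjecture.CorCM.Model.RecordSystemConj.conjFrame (Summit.HodgeConjecture.CorCM.Model.frameOf (⟨HodgeCM.HermSpace3.Hm V, HodgeCM.HermSpace3.isHermitian V, HodgeCM.HermSpace3.signature_ι₁ V, HodgeCM.HermSpace3.posDef_of_ne V⟩ : Summit.HodgeConjecture.CorCM.HermSpace3 ⟨HodgeCM.CMField.K F⟩ ι₁)))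
        (Summit.HodgeConjecture.CorCM.Model.RecordSystemConj.formCongr_conjFrame (HodgeCM.CMField.K F) (HodgeCM.HermSpace3.Hm V) ι₁ (Summit.HodgeConjecture.CorCM.Model.frameOf (⟨HodgeCM.HermSpace3.Hm V, HodgeCM.HermSpace3.isHermitian V, HodgeCM.HermSpace3.signature_ι₁ V, HodgeCM.HermSpace3.posDef_of_ne V⟩ : Summit.HodgeConjecture.CorCM.HermSpace3 ⟨HodgeCM.CMField.K F⟩ ι₁))
          (Summit.HodgeConjecture.CorCM.Model.formCongr_frameOf (⟨HodgeCM.HermSpace3.Hm V, HodgeCM.HermSpace3.isHermitian V, HodgeCM.HermSpace3.signature_ι₁ V, HodgeCM.HermSpace3.posDef_of_ne V⟩ : Summit.HodgeConjecture.CorCM.HermSpace3 ⟨HodgeCM.CMField.K F⟩ ι₁)))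
        (Summit.HodgeConjecture.CorCM.Model.RecordSystemConj.conjLevel₀ (HodgeCM.CMField.K F) (HodgeCM.HermSpace3.Hm V) (Summit.HodgeConjecture.CorCM.HComp.K3 (⟨HodgeCM.HermSpace3.Hm V, HodgeCM.HermSpace3.isHermitian V, HodgeCM.HermSpace3.signature_ι₁ V, HodgeCM.HermSpace3.posDef_of_ne V⟩ : Summit.HodgeConjecture.CorCM.HermSpace3 ⟨HodgeCM.CMField.K F⟩ ι₁)))) (_ : CMType F),
      CategoryTheory.Functor.comp (Summit.HodgeConjecture.CorCM.Model.RecordSystemConj.smallLevelConjBack (HodgeCM.CMField.K F) (HodgeCM.HermSpace3.Hm V) (Summit.HodgeConjecture.CorCM.HComp.K3 (⟨HodgeCM.HermSpace3.Hm V, HodgeCM.HermSpace3.isHermitian V, HodgeCM.HermSpace3.signature_ι₁ V, HodgeCM.HermSpace3.posDef_of_ne V⟩ : Summit.HodgeConjecture.CorCM.HermSpace3 ⟨HodgeCM.CMField.K F⟩ ι₁))) (Summit.HodgeConjecture.CorCM.Model.sec42DataOfFourLe (Summit.HodgeConjecture.CorCM.DelRec.exists_recordSystem_of_printed hDel) (⟨HodgeCM.HermSpace3.Hm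 V, HodgeCM.HermSpace3.isHermitian V, HodgeCM.HermSpace3.signature_ι₁ V, HodgeCM.HermSpace3.posDef_of_ne V⟩ : Summit.HodgeConjecture.CorCM.HermSpace3 ⟨HodgeCM.CMField.K F⟩ ι₁) Φ (le_trans (Nat.le_of_ble_eq_true rfl) h6) (isoOf ⟨HodgeCM.CMField.K F⟩ ι₁ (⟨HodgeCM.HermSpace3.Hm V, HodgeCM.HermSpace3.isHermitian V, HodgeCM.HermSpace3.signature_ι₁ V, HodgeCM.HermSpace3.posDef_of_ne V⟩ : Summit.HodgeConjecture.CorCM.HermSpace3 ⟨HodgeCM.CMField.K F⟩ ι₁) Φ)).cpt.X = R'.M ∧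
        ∀ K : Subgroup (Summit.HodgeConjecture.CorCM.Model.honestP5Of (Summit.HodgeConjecture.CorCM.DelRec.exists_recordSystem_of_printed hDel) ⟨HodgeCM.CMField.K F⟩ ι₁ ⟨HodgeCM.HermSpace3.Hm V, HodgeCM.HermSpace3.isHermitian V, HodgeCM.HermSpace3.signature_ι₁ V, HodgeCM.HermSpace3.posDef_of_ne V⟩ Φ).G,
          (sec42DataOf (Summit.HodgeConjecture.CorCM.DelRec.exists_recordSystem_of_printed hDel) isoOf ⟨HodgeCM.CMField.K F⟩ ι₁ ⟨HodgeCM.HermSpace3.Hm V, HodgeCM.HermSpace3.isHermitian V, HodgeCM.HermSpace3.signature_ι₁ V, HodgeCM.HermSpace3.posDef_of_ne V⟩ Φ).X ((sec42DataOf (Summit.HodgeConjecture.CorCM.DelRec.exists_recordSystem_of_printed hDel) isoOf ⟨HodgeCM.CMField.K F⟩ ι₁ ⟨HodgeCM.HermSpace3.Hm V, HodgeCM.HermSpace3.isHermitian V, HodgeCM.HermSpace3.signature_ι₁ V, HodgeCM.HermSpace3.posDef_of_ne V⟩ Φ).levelOf K) =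
            R'.M.obj (⟨C5.OpenCompactSubgroup.transport (Summit.HodgeConjecture.CorCM.Model.RecordSystemConj.groupConj (HodgeCM.CMField.K F) (HodgeCM.HermSpace3.Hm V)) ((Summit.HodgeConjecture.CorCM.Model.sec42DataOfFourLe (Summit.HodgeConjecture.CorCM.DelRec.exists_recordSystem_of_printed hDel) (⟨HodgeCM.HermSpace3.Hm V, HodgeCM.HermSpace3.isHermitian V, HodgeCM.HermSpace3.signature_ι₁ V, HodgeCM.HermSpace3.posDef_of_ne V⟩ : Summit.HodgeConjecture.CorCM.HermSpace3 ⟨HodgeCM.CMField.K F⟩ ι₁) Φ (le_trans (Nat.le_of_ble_eq_true rfl) h6) (isoOf ⟨HodgeCM.CMField.K F⟩ ι₁ (⟨HodgeCM.HermSpace3.Hm V, HodgeCM.HermSpace3.isHermitian V, HodgeCM.HermSpace3.signature_ι₁ V, HodgeCM.HermSpace3.posDef_of_ne V⟩ : Summit.HodgeConjecture.CorCM.HermSpace3 ⟨HodgeCM.CMField.K F⟩ ι₁) Φ)).levelOf K).1,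
              C5.OpenCompactSubgroup.transport_mono (Summit.HodgeConjecture.CorCM.Model.RecordSystemConj.groupConj (HodgeCM.CMField.K F) (HodgeCM.HermSpace3.Hm V)) ((Summit.HodgeConjecture.CorCM.Model.sec42DataOfFourLe (Summit.HodgeConjecture.CorCM.DelRec.exists_recordSystem_of_printed hDel) (⟨HodgeCM.HermSpace3.Hm V, HodgeCM.HermSpace3.isHermitian V, HodgeCM.HermSpace3.signature_ι₁ V, HodgeCM.HermSpace3.posDef_of_ne V⟩ : Summit.HodgeConjecture.CorCM.HermSpace3 ⟨HodgeCM.CMField.K F⟩ ι₁) Φ (le_trans (Nat.le_of_ble_eq_true rfl) h6) (isoOf ⟨HodgeCM.CMField.K F⟩ ι₁ (⟨HodgeCM.HermSpace3.Hm V, HodgeCM.HermSpace3.isHermitian V, HodgeCM.HermSpace3.signature_ι₁ V, HodgeCM.HermSpace3.posDef_of_ne V⟩ : Summit.HodgeConjecture.CorCM.HermSpace3 ⟨HodgeCM.CMField.K F⟩ ι₁) Φ)).levelOf K).2⟩ :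
              C5.SmallLevel (Summit.HodgeConjecture.CorCM.Model.RecordSystemConj.conjLevel₀ (HodgeCM.CMField.K F) (HodgeCM.HermSpace3.Hm V) (Summit.HodgeConjecture.CorCM.HComp.K3 (⟨HodgeCM.HermSpace3.Hm V, HodgeCM.HermSpace3.isHermitian V, HodgeCM.HermSpace3.signature_ι₁ V, HodgeCM.HermSpace3.posDef_of_ne V⟩ : Summit.HodgeConjecture.CorCM.HermSpace3 ⟨HodgeCM.CMField.K F⟩ ι₁)))) := by
  obtain ⟨Φ, hΦ, ν, hν, hw, -⟩ := exists_tail_character F ι₁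
  obtain ⟨R', hR'⟩ :=
    Summit.HodgeConjecture.CorCM.D2Bridge.MuConjIdent.exists_recordSystemConj_X_sec42DataOf_levelOf_eq
      (Summit.HodgeConjecture.CorCM.DelRec.exists_recordSystem_of_printed hDel) (⟨HodgeCM.HermSpace3.Hm V, HodgeCM.HermSpace3.isHermitian V, HodgeCM.HermSpace3.signature_ι₁ V, HodgeCM.HermSpace3.posDef_of_ne V⟩ : Summit.HodgeConjecture.CorCM.HermSpace3 ⟨HodgeCM.CMField.K F⟩ ι₁) Φ isoOf h6
  exact ⟨⟨1, map_one _, one_ne_zero⟩, Φ, hΦ, ν, hν, hw, R', Φ, hR'⟩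

/-- **The whole `HypLiu418` telescope after the head `(F, h6, ι₁, V)` is inhabited, its `hDel` binder INCLUDED** — discharged by the tree's
Mathlib-only proof ★ `HCCMUnconditionalHDelOfF0.HDel_holds` of item 24835. [cite: Liu2021, Thm 4.18 p. 52]
[cite: Deligne1979ShimuraVarieties, §2.2.5 and Cor. 2.7.21] -/
theorem hypLiu418_telescope_inhabited_of_head
    (F : HodgeCM.CMField) (h6 : 6 ≤ Module.finrank ℚ F) {ι₁ : F →+* ℂ} (V : HodgeCM.HermSpace3 F ι₁) :
    ∃ (hDel : Literature.AlgebraicGeometry.ShimuraVarieties.UnitaryCanonicalModel.canonicalModel_exists_printed)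
      (_ : RealScalar F) (Φ : CMType F) (_ : ι₁ ∈ Φ.1) (ν : Literature.NumberTheory.Automorphic.IdeleClassGroup (F : Type) →ₜ* Circle)
      (_ : IdeleClassGroup.IsConjugateSymplectic (F : Type) ν) (_ : IdeleClassGroup.HasWeight (F : Type) ν 1)
      (R' : RecordSystem (HodgeCM.CMField.K F) (Summit.HodgeConjecture.CorCM.Model.RecordSystemConj.conjGram (HodgeCM.CMField.K F) (HodgeCM.HermSpace3.Hm V)) ι₁
        (Summit.HodgeConjecture.CorCM.Model.RecordSystemConj.conjFrame (Summit.HodgeConjecture.CorCM.Model.frameOf (⟨HodgeCM.HermSpace3.Hm V, HodgeCM.HermSpace3.isHermitian V, HodgeCM.HermSpace3.signature_ι₁ V, HodgeCM.HermSpace3.posDef_of_ne V⟩ : Summit.HodgeConjecture.CorCM.HermSpace3 ⟨HodgeCM.CMField.K F⟩ ι₁)))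
        (Summit.HodgeConjecture.CorCM.Model.RecordSystemConj.formCongr_conjFrame (HodgeCM.CMField.K F) (HodgeCM.HermSpace3.Hm V) ι₁ (Summit.HodgeConjecture.CorCM.Model.frameOf (⟨HodgeCM.HermSpace3.Hm V, HodgeCM.HermSpace3.isHermitian V, HodgeCM.HermSpace3.signature_ι₁ V, HodgeCM.HermSpace3.posDef_of_ne V⟩ : Summit.HodgeConjecture.CorCM.HermSpace3 ⟨HodgeCM.CMField.K F⟩ ι₁))
          (Summit.HodgeConjecture.CorCM.Model.formCongr_frameOf (⟨HodgeCM.HermSpace3.Hm V, HodgeCM.HermSpace3.isHermitian V, HodgeCM.HermSpace3.signature_ι₁ V, HodgeCM.HermSpace3.posDef_of_ne V⟩ : Summit.HodgeConjecture.CorCM.HermSpace3 ⟨HodgeCM.CMField.K F⟩ ι₁)))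
        (Summit.HodgeConjecture.CorCM.Model.RecordSystemConj.conjLevel₀ (HodgeCM.CMField.K F) (HodgeCM.HermSpace3.Hm V) (Summit.HodgeConjecture.CorCM.HComp.K3 (⟨HodgeCM.HermSpace3.Hm V, HodgeCM.HermSpace3.isHermitian V, HodgeCM.HermSpace3.signature_ι₁ V, HodgeCM.HermSpace3.posDef_of_ne V⟩ : Summit.HodgeConjecture.CorCM.HermSpace3 ⟨HodgeCM.CMField.K F⟩ ι₁)))) (_ : CMType F),
      CategoryTheory.Functor.comp (Summit.HodgeConjecture.CorCM.Model.RecordSystemConj.smallLevelConjBack (HodgeCM.CMField.K F) (HodgeCM.HermSpace3.Hm V) (Summit.HodgeConjecture.CorCM.HComp.K3 (⟨HodgeCM.HermSpace3.Hm V, HodgeCM.HermSpace3.isHermitian V, HodgeCM.HermSpace3.signature_ι₁ V, HodgeCM.HermSpace3.posDef_of_ne V⟩ : Summit.HodgeConjecture.CorCM.HermSpace3 ⟨HodgeCM.CMField.K F⟩ ι₁))) (Summit.HodgeConjecture.CorCM.Model.sec42DataOfFourLe (Summit.HodgeConjecture.CorCM.DelRec.exists_recordSystem_of_printed hDel) (⟨HodgeCM.HermSpace3.Hm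 V, HodgeCM.HermSpace3.isHermitian V, HodgeCM.HermSpace3.signature_ι₁ V, HodgeCM.HermSpace3.posDef_of_ne V⟩ : Summit.HodgeConjecture.CorCM.HermSpace3 ⟨HodgeCM.CMField.K F⟩ ι₁) Φ (le_trans (Nat.le_of_ble_eq_true rfl) h6) (isoOf ⟨HodgeCM.CMField.K F⟩ ι₁ (⟨HodgeCM.HermSpace3.Hm V, HodgeCM.HermSpace3.isHermitian V, HodgeCM.HermSpace3.signature_ι₁ V, HodgeCM.HermSpace3.posDef_of_ne V⟩ : Summit.HodgeConjecture.CorCM.HermSpace3 ⟨HodgeCM.CMField.K F⟩ ι₁) Φ)).cpt.X = R'.M ∧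
        ∀ K : Subgroup (Summit.HodgeConjecture.CorCM.Model.honestP5Of (Summit.HodgeConjecture.CorCM.DelRec.exists_recordSystem_of_printed hDel) ⟨HodgeCM.CMField.K F⟩ ι₁ ⟨HodgeCM.HermSpace3.Hm V, HodgeCM.HermSpace3.isHermitian V, HodgeCM.HermSpace3.signature_ι₁ V, HodgeCM.HermSpace3.posDef_of_ne V⟩ Φ).G,
          (sec42DataOf (Summit.HodgeConjecture.CorCM.DelRec.exists_recordSystem_of_printed hDel) isoOf ⟨HodgeCM.CMField.K F⟩ ι₁ ⟨HodgeCM.HermSpace3.Hm V, HodgeCM.HermSpace3.isHermitian V, HodgeCM.HermSpace3.signature_ι₁ V, HodgeCM.HermSpace3.posDef_of_ne V⟩ Φ).X ((sec42DataOf (Summit.HodgeConjecture.CorCM.DelRec.exists_recordSystem_of_printed hDel) isoOf ⟨HodgeCM.CMField.K F⟩ ι₁ ⟨HodgeCM.HermSpace3.Hm V, HodgeCM.HermSpace3.isHermitian V, HodgeCM.HermSpace3.signature_ι₁ V, HodgeCM.HermSpace3.posDef_of_ne V⟩ Φ).levelOf K) =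
            R'.M.obj (⟨C5.OpenCompactSubgroup.transport (Summit.HodgeConjecture.CorCM.Model.RecordSystemConj.groupConj (HodgeCM.CMField.K F) (HodgeCM.HermSpace3.Hm V)) ((Summit.HodgeConjecture.CorCM.Model.sec42DataOfFourLe (Summit.HodgeConjecture.CorCM.DelRec.exists_recordSystem_of_printed hDel) (⟨HodgeCM.HermSpace3.Hm V, HodgeCM.HermSpace3.isHermitian V, HodgeCM.HermSpace3.signature_ι₁ V, HodgeCM.HermSpace3.posDef_of_ne V⟩ : Summit.HodgeConjecture.CorCM.HermSpace3 ⟨HodgeCM.CMField.K F⟩ ι₁) Φ (le_trans (Nat.le_of_ble_eq_true rfl) h6) (isoOf ⟨HodgeCM.CMField.K F⟩ ι₁ (⟨HodgeCM.HermSpace3.Hm V, HodgeCM.HermSpace3.isHermitian V, HodgeCM.HermSpace3.signature_ι₁ V, HodgeCM.HermSpace3.posDef_of_ne V⟩ : Summit.HodgeConjecture.CorCM.HermSpace3 ⟨HodgeCM.CMField.K F⟩ ι₁) Φ)).levelOf K).1,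
              C5.OpenCompactSubgroup.transport_mono (Summit.HodgeConjecture.CorCM.Model.RecordSystemConj.groupConj (HodgeCM.CMField.K F) (HodgeCM.HermSpace3.Hm V)) ((Summit.HodgeConjecture.CorCM.Model.sec42DataOfFourLe (Summit.HodgeConjecture.CorCM.DelRec.exists_recordSystem_of_printed hDel) (⟨HodgeCM.HermSpace3.Hm V, HodgeCM.HermSpace3.isHermitian V, HodgeCM.HermSpace3.signature_ι₁ V, HodgeCM.HermSpace3.posDef_of_ne V⟩ : Summit.HodgeConjecture.CorCM.HermSpace3 ⟨HodgeCM.CMField.K F⟩ ι₁) Φ (le_trans (Nat.le_of_ble_eq_true rfl) h6) (isoOf ⟨HodgeCM.CMField.K F⟩ ι₁ (⟨HodgeCM.HermSpace3.Hm V, HodgeCM.HermSpace3.isHermitian V, HodgeCM.HermSpace3.signature_ι₁ V, HodgeCM.HermSpace3.posDef_of_ne V⟩ : Summit.HodgeConjecture.CorCM.HermSpace3 ⟨HodgeCM.CMField.K F⟩ ι₁) Φ)).levelOf K).2⟩ :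
              C5.SmallLevel (Summit.HodgeConjecture.CorCM.Model.RecordSystemConj.conjLevel₀ (HodgeCM.CMField.K F) (HodgeCM.HermSpace3.Hm V) (Summit.HodgeConjecture.CorCM.HComp.K3 (⟨HodgeCM.HermSpace3.Hm V, HodgeCM.HermSpace3.isHermitian V, HodgeCM.HermSpace3.signature_ι₁ V, HodgeCM.HermSpace3.posDef_of_ne V⟩ : Summit.HodgeConjecture.CorCM.HermSpace3 ⟨HodgeCM.CMField.K F⟩ ι₁)))) := by
  have hDel : Literature.AlgebraicGeometry.ShimuraVarieties.UnitaryCanonicalModel.canonicalModel_exists_printed :=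
    Summit.HodgeConjecture.HodgeConjecture.Theorems.HCCMUnconditionalHDelOfF0.HDel_holds
  exact ⟨hDel, hypLiu418_tail_inhabited hDel F h6 V⟩

/-! ## §4 The `Hyp413` tail: the pinned Liu index -/

/-- **The `Hyp413` tail is inhabited over every head at E's orientation**: for `hemb : (InfinitePlace.mk ι₁).embedding = ι₁` and every pointing
scalar `a₀` there are a CM type `Φ ∋ ι₁` and an index `i : I V (repAt a₀) (muLiu ι₁ GramClass.rep)` (★ `IndexInhabited.nonempty_index`:
the index line of a conjugate-symplectic weight-one character of type `Φ^δ(a₀)`).  Without `hemb` the index is empty (orientation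
obstruction, `D2Bridge/T5IsometricBlockObstruction`), where the `Hyp413` row is vacuously true and unused.
[cite: Liu2021, Def. 4.12 p. 47, Prop. 4.13 p. 47] [cite: WeilBNT1967, Ch. VII §3] -/
theorem hyp413_tail_inhabited (F : HodgeCM.CMField) {ι₁ : F →+* ℂ} (hemb : (InfinitePlace.mk ι₁).embedding = ι₁)
    (V : HodgeCM.HermSpace3 F ι₁) (a₀ : RealScalar F) :
    ∃ (Φ : CMType F) (_ : ι₁ ∈ Φ.1), Nonempty (I V (repAt a₀) (muLiu ι₁ GramClass.rep)) := by
  obtain ⟨Φ, hΦ⟩ := exists_cmType_mem F ι₁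
  exact ⟨Φ, hΦ, Summit.HodgeConjecture.CorCM.D2Bridge.IndexInhabited.nonempty_index V hemb a₀⟩

/-- **Head-parametric `Hyp413` telescope**: over every CM field there are an embedding `ι₁` at E's orientation and, for every `V` and `a₀`
there, the whole tail. [cite: Liu2021, Prop. 4.13 p. 47] -/
theorem hyp413_telescope_inhabited (F : HodgeCM.CMField) :
    ∃ ι₁ : F →+* ℂ, (InfinitePlace.mk ι₁).embedding = ι₁ ∧
      ∀ (V : HodgeCM.HermSpace3 F ι₁) (a₀ : RealScalar F),
        ∃ (Φ : CMType F) (_ : ι₁ ∈ Φ.1), Nonempty (I V (repAt a₀) (muLiu ι₁ GramClass.rep)) := by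
  obtain ⟨ι₁, hemb⟩ := exists_embedding_mk_embedding_eq F
  exact ⟨ι₁, hemb, fun V a₀ => hyp413_tail_inhabited F hemb V a₀⟩

/-! ## §5 The `HypD1pp` ∕ `HypD3` indices -/

/-- **The admissible index `j` of the `HypD1pp` row is inhabited** for every head and every `(a, Φ, μ, hμ, hw)`: the [Def. 4.11] datum
`toThm418Data _ (restOfCharDeltaPrime hDel …) μ hμ hw` has a `μ`-admissible `(ε, χ)` (★ `Thm418Data.nonempty_admIndex` at the trivial `χ`).
[cite: Liu2021, Def. 4.12 p. 47, App. D Lem D.1 (1) p. 125] -/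
theorem hypD1pp_index_inhabited
    (hDel : Literature.AlgebraicGeometry.ShimuraVarieties.UnitaryCanonicalModel.canonicalModel_exists_printed)
    (F : HodgeCM.CMField) [IsGalois ℚ F] (h6 : 6 ≤ Module.finrank ℚ F) {ι₁ : F →+* ℂ} (V : HodgeCM.HermSpace3 F ι₁) (a : RealScalar F)
    (Φ : CMType F) (μ : Literature.NumberTheory.Automorphic.IdeleClassGroup (F : Type) →ₜ* Circle)
    (hμ : IdeleClassGroup.IsConjugateSymplectic (F : Type) μ) (hw : IdeleClassGroup.HasWeight (F : Type) μ 1) :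
    Nonempty ((toThm418Data _ (restOfCharDeltaPrime (Summit.HodgeConjecture.CorCM.DelRec.exists_recordSystem_of_printed hDel) ⟨HodgeCM.CMField.K F⟩ h6 ι₁ ⟨HodgeCM.HermSpace3.Hm V, HodgeCM.HermSpace3.isHermitian V, HodgeCM.HermSpace3.signature_ι₁ V, HodgeCM.HermSpace3.posDef_of_ne V⟩ Φ e₁ (frameD V) (frameD_real V) (frameD_ne V) (ιVE V) (Rep.update ↥(maximalRealSubfield (HodgeCM.CMField.K F)) (imagUnitSq (HodgeCM.CMField.K F)) (Rep.ofLineOf ↥(maximalRealSubfield (HodgeCM.CMField.K F)) (imagUnitSq (HodgeCM.CMField.K F))) (locF ↥(maximalRealSubfield (HodgeCM.CMField.K F)) (imagUnitSq (HodgeCM.CMField.K F)) (realUnit ⟨HodgeCM.CMField.K F⟩ a.1 a.2.1 a.2.2)) (realUnit ⟨HodgeCM.CMField.K F⟩ a.1 a.2.1 a.2.2) rfl) μ hμ hw)).AdmIndex) :=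
  Literature.NumberTheory.Automorphic.Liu2021.Thm418Data.nonempty_admIndex
    (default : Def411WeilCarriers.Chi ↥(maximalRealSubfield (F : Type)) (F : Type) (IsCMField.complexConj (F : Type)))

/-- **The index `ι = Σ μw, AdmIndex` of the `HypD3` row's indexed family is inhabited** for every head and every `(a, Φ)`: a
conjugate-symplectic weight-one `μ` of type `Φ` (§2) paired with an admissible `(ε, χ)` (★ `nonempty_admIndex`).
[cite: Liu2021, App. D Lem D.1 (3) p. 125] [cite: WeilBNT1967, Ch. VII §3] -/
theorem hypD3_index_inhabited
    (hDel : Literature.AlgebraicGeometry.ShimuraVarieties.UnitaryCanonicalModel.canonicalModel_exists_printed)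
    (F : HodgeCM.CMField) [IsGalois ℚ F] (h6 : 6 ≤ Module.finrank ℚ F) {ι₁ : F →+* ℂ} (V : HodgeCM.HermSpace3 F ι₁) (a : RealScalar F)
    (Φ : CMType F) :
    Nonempty (((μw : {μ : Literature.NumberTheory.Automorphic.IdeleClassGroup (F : Type) →ₜ* Circle // IdeleClassGroup.IsConjugateSymplectic (F : Type) μ ∧ IdeleClassGroup.HasWeight (F : Type) μ 1}) × (toThm418Data _ (restOfCharDeltaPrime (Summit.HodgeConjecture.CorCM.DelRec.exists_recordSystem_of_printed hDel) ⟨HodgeCM.CMField.K F⟩ h6 ι₁ ⟨HodgeCM.HermSpace3.Hm V, HodgeCM.HermSpace3.isHermitian V, HodgeCM.HermSpace3.signature_ι₁ V, HodgeCM.HermSpace3.posDef_of_ne V⟩ Φ e₁ (frameD V) (frameD_real V) (frameD_ne V) (ιVE V) (Rep.update ↥(maximalRealSubfield (HodgeCM.CMField.K F)) (imagUnitSq (HodgeCM.CMField.K F)) (Rep.ofLineOf ↥(maximalRealSubfield (HodgeCM.CMField.K F)) (imagUnitSq (HodgeCM.CMField.K F))) (locF ↥(maximalRealSubfield (HodgeCM.CMField.K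 F)) (imagUnitSq (HodgeCM.CMField.K F)) (realUnit ⟨HodgeCM.CMField.K F⟩ a.1 a.2.1 a.2.2)) (realUnit ⟨HodgeCM.CMField.K F⟩ a.1 a.2.1 a.2.2) rfl) μw.1 μw.2.1 μw.2.2)).AdmIndex)) := by
  obtain ⟨μ, hμ, hw, -⟩ := IdeleClassGroup.exists_isConjugateSymplectic_hasCMType (L := (F : Type)) Φ
  obtain ⟨j⟩ := hypD1pp_index_inhabited hDel F h6 V a Φ μ hμ hw
  exact ⟨⟨⟨μ, hμ, hw⟩, j⟩⟩

/-! ## §6 Composition: every printed-citation binder tail at one head -/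

/-- **All five printed-citation ∀-telescopes are inhabited after any head `(F, h6, ι₁, V)` at E's orientation `hemb`** (director s460 (iii)):
the conjunction of §3 (`HypLiu418`, its `hDel` binder included and discharged by ★ `HDel_holds`), §4 (`Hyp413`, for EVERY pointing scalar `a₀`),
§2 (`Hyp411`), §5 (`HypD1pp` index `j` and `HypD3` index `ι`, for EVERY proof `hDel` and all `(a, Φ, μ, hμ, hw)`) and §1 (the finite place `v`).
Composed with a head witness `(F, [IsGalois ℚ F], h6, ι₁ := w.embedding, V)` (NONVAC-II ★ p810711, `ℚ(ζ₇)`) this is the full inhabitation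
witness of every structure the headline's seven hypotheses quantify over.  HC_CM is NOT proved unconditionally by this.
[cite: Liu2021, Thm 4.18 p. 52, Prop. 4.13 p. 47, Def. 4.11–4.12 pp. 46–47, App. D Lem D.1 p. 125] [cite: WeilBNT1967, Ch. VII §3] -/
theorem hccm_binders_inhabited_at (F : HodgeCM.CMField) [IsGalois ℚ F] (h6 : 6 ≤ Module.finrank ℚ F) {ι₁ : F →+* ℂ}
    (V : HodgeCM.HermSpace3 F ι₁) (hemb : (InfinitePlace.mk ι₁).embedding = ι₁) :
    (∃ (hDel : Literature.AlgebraicGeometry.ShimuraVarieties.UnitaryCanonicalModel.canonicalModel_exists_printed)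
      (_ : RealScalar F) (Φ : CMType F) (_ : ι₁ ∈ Φ.1) (ν : Literature.NumberTheory.Automorphic.IdeleClassGroup (F : Type) →ₜ* Circle)
      (_ : IdeleClassGroup.IsConjugateSymplectic (F : Type) ν) (_ : IdeleClassGroup.HasWeight (F : Type) ν 1)
      (R' : RecordSystem (HodgeCM.CMField.K F) (Summit.HodgeConjecture.CorCM.Model.RecordSystemConj.conjGram (HodgeCM.CMField.K F) (HodgeCM.HermSpace3.Hm V)) ι₁
        (Summit.HodgeConjecture.CorCM.Model.RecordSystemConj.conjFrame (Summit.HodgeConjecture.CorCM.Model.frameOf (⟨HodgeCM.HermSpace3.Hm V, HodgeCM.HermSpace3.isHermitian V, HodgeCM.HermSpace3.signature_ι₁ V, HodgeCM.HermSpace3.posDef_of_ne V⟩ : Summit.HodgeConjecture.CorCM.HermSpace3 ⟨HodgeCM.CMField.K F⟩ ι₁)))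
        (Summit.HodgeConjecture.CorCM.Model.RecordSystemConj.formCongr_conjFrame (HodgeCM.CMField.K F) (HodgeCM.HermSpace3.Hm V) ι₁ (Summit.HodgeConjecture.CorCM.Model.frameOf (⟨HodgeCM.HermSpace3.Hm V, HodgeCM.HermSpace3.isHermitian V, HodgeCM.HermSpace3.signature_ι₁ V, HodgeCM.HermSpace3.posDef_of_ne V⟩ : Summit.HodgeConjecture.CorCM.HermSpace3 ⟨HodgeCM.CMField.K F⟩ ι₁))
          (Summit.HodgeConjecture.CorCM.Model.formCongr_frameOf (⟨HodgeCM.HermSpace3.Hm V, HodgeCM.HermSpace3.isHermitian V, HodgeCM.HermSpace3.signature_ι₁ V, HodgeCM.HermSpace3.posDef_of_ne V⟩ : Summit.HodgeConjecture.CorCM.HermSpace3 ⟨HodgeCM.CMField.K F⟩ ι₁)))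
        (Summit.HodgeConjecture.CorCM.Model.RecordSystemConj.conjLevel₀ (HodgeCM.CMField.K F) (HodgeCM.HermSpace3.Hm V) (Summit.HodgeConjecture.CorCM.HComp.K3 (⟨HodgeCM.HermSpace3.Hm V, HodgeCM.HermSpace3.isHermitian V, HodgeCM.HermSpace3.signature_ι₁ V, HodgeCM.HermSpace3.posDef_of_ne V⟩ : Summit.HodgeConjecture.CorCM.HermSpace3 ⟨HodgeCM.CMField.K F⟩ ι₁)))) (_ : CMType F),
      CategoryTheory.Functor.comp (Summit.HodgeConjecture.CorCM.Model.RecordSystemConj.smallLevelConjBack (HodgeCM.CMField.K F) (HodgeCM.HermSpace3.Hm V) (Summit.HodgeConjecture.CorCM.HComp.K3 (⟨HodgeCM.HermSpace3.Hm V, HodgeCM.HermSpace3.isHermitian V, HodgeCM.HermSpace3.signature_ι₁ V, HodgeCM.HermSpace3.posDef_of_ne V⟩ : Summit.HodgeConjecture.CorCM.HermSpace3 ⟨HodgeCM.CMField.K F⟩ ι₁))) (Summit.HodgeConjecture.CorCM.Model.sec42DataOfFourLe (Summit.HodgeConjecture.CorCM.DelRec.exists_recordSystem_of_printed hDel) (⟨HodgeCM.HermSpace3.Hm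 V, HodgeCM.HermSpace3.isHermitian V, HodgeCM.HermSpace3.signature_ι₁ V, HodgeCM.HermSpace3.posDef_of_ne V⟩ : Summit.HodgeConjecture.CorCM.HermSpace3 ⟨HodgeCM.CMField.K F⟩ ι₁) Φ (le_trans (Nat.le_of_ble_eq_true rfl) h6) (isoOf ⟨HodgeCM.CMField.K F⟩ ι₁ (⟨HodgeCM.HermSpace3.Hm V, HodgeCM.HermSpace3.isHermitian V, HodgeCM.HermSpace3.signature_ι₁ V, HodgeCM.HermSpace3.posDef_of_ne V⟩ : Summit.HodgeConjecture.CorCM.HermSpace3 ⟨HodgeCM.CMField.K F⟩ ι₁) Φ)).cpt.X = R'.M ∧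
        ∀ K : Subgroup (Summit.HodgeConjecture.CorCM.Model.honestP5Of (Summit.HodgeConjecture.CorCM.DelRec.exists_recordSystem_of_printed hDel) ⟨HodgeCM.CMField.K F⟩ ι₁ ⟨HodgeCM.HermSpace3.Hm V, HodgeCM.HermSpace3.isHermitian V, HodgeCM.HermSpace3.signature_ι₁ V, HodgeCM.HermSpace3.posDef_of_ne V⟩ Φ).G,
          (sec42DataOf (Summit.HodgeConjecture.CorCM.DelRec.exists_recordSystem_of_printed hDel) isoOf ⟨HodgeCM.CMField.K F⟩ ι₁ ⟨HodgeCM.HermSpace3.Hm V, HodgeCM.HermSpace3.isHermitian V, HodgeCM.HermSpace3.signature_ι₁ V, HodgeCM.HermSpace3.posDef_of_ne V⟩ Φ).X ((sec42DataOf (Summit.HodgeConjecture.CorCM.DelRec.exists_recordSystem_of_printed hDel) isoOf ⟨HodgeCM.CMField.K F⟩ ι₁ ⟨HodgeCM.HermSpace3.Hm V, HodgeCM.HermSpace3.isHermitian V, HodgeCM.HermSpace3.signature_ι₁ V, HodgeCM.HermSpace3.posDef_of_ne V⟩ Φ).levelOf K) =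
            R'.M.obj (⟨C5.OpenCompactSubgroup.transport (Summit.HodgeConjecture.CorCM.Model.RecordSystemConj.groupConj (HodgeCM.CMField.K F) (HodgeCM.HermSpace3.Hm V)) ((Summit.HodgeConjecture.CorCM.Model.sec42DataOfFourLe (Summit.HodgeConjecture.CorCM.DelRec.exists_recordSystem_of_printed hDel) (⟨HodgeCM.HermSpace3.Hm V, HodgeCM.HermSpace3.isHermitian V, HodgeCM.HermSpace3.signature_ι₁ V, HodgeCM.HermSpace3.posDef_of_ne V⟩ : Summit.HodgeConjecture.CorCM.HermSpace3 ⟨HodgeCM.CMField.K F⟩ ι₁) Φ (le_trans (Nat.le_of_ble_eq_true rfl) h6) (isoOf ⟨HodgeCM.CMField.K F⟩ ι₁ (⟨HodgeCM.HermSpace3.Hm V, HodgeCM.HermSpace3.isHermitian V, HodgeCM.HermSpace3.signature_ι₁ V, HodgeCM.HermSpace3.posDef_of_ne V⟩ : Summit.HodgeConjecture.CorCM.HermSpace3 ⟨HodgeCM.CMField.K F⟩ ι₁) Φ)).levelOf K).1,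
              C5.OpenCompactSubgroup.transport_mono (Summit.HodgeConjecture.CorCM.Model.RecordSystemConj.groupConj (HodgeCM.CMField.K F) (HodgeCM.HermSpace3.Hm V)) ((Summit.HodgeConjecture.CorCM.Model.sec42DataOfFourLe (Summit.HodgeConjecture.CorCM.DelRec.exists_recordSystem_of_printed hDel) (⟨HodgeCM.HermSpace3.Hm V, HodgeCM.HermSpace3.isHermitian V, HodgeCM.HermSpace3.signature_ι₁ V, HodgeCM.HermSpace3.posDef_of_ne V⟩ : Summit.HodgeConjecture.CorCM.HermSpace3 ⟨HodgeCM.CMField.K F⟩ ι₁) Φ (le_trans (Nat.le_of_ble_eq_true rfl) h6) (isoOf ⟨HodgeCM.CMField.K F⟩ ι₁ (⟨HodgeCM.HermSpace3.Hm V, HodgeCM.HermSpace3.isHermitian V, HodgeCM.HermSpace3.signature_ι₁ V, HodgeCM.HermSpace3.posDef_of_ne V⟩ : Summit.HodgeConjecture.CorCM.HermSpace3 ⟨HodgeCM.CMField.K F⟩ ι₁) Φ)).levelOf K).2⟩ :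
              C5.SmallLevel (Summit.HodgeConjecture.CorCM.Model.RecordSystemConj.conjLevel₀ (HodgeCM.CMField.K F) (HodgeCM.HermSpace3.Hm V) (Summit.HodgeConjecture.CorCM.HComp.K3 (⟨HodgeCM.HermSpace3.Hm V, HodgeCM.HermSpace3.isHermitian V, HodgeCM.HermSpace3.signature_ι₁ V, HodgeCM.HermSpace3.posDef_of_ne V⟩ : Summit.HodgeConjecture.CorCM.HermSpace3 ⟨HodgeCM.CMField.K F⟩ ι₁))))) ∧
    (∀ a₀ : RealScalar F, ∃ (Φ : CMType F) (_ : ι₁ ∈ Φ.1), Nonempty (I V (repAt a₀) (muLiu ι₁ GramClass.rep))) ∧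
    (∃ (_ : RealScalar F) (Φ : CMType F) (_ : ι₁ ∈ Φ.1) (μ : Literature.NumberTheory.Automorphic.IdeleClassGroup (F : Type) →ₜ* Circle)
      (_ : IdeleClassGroup.IsConjugateSymplectic (F : Type) μ), IdeleClassGroup.HasWeight (F : Type) μ 1) ∧
    (∀ (hDel : Literature.AlgebraicGeometry.ShimuraVarieties.UnitaryCanonicalModel.canonicalModel_exists_printed) (a : RealScalar F)
      (Φ : CMType F) (μ : Literature.NumberTheory.Automorphic.IdeleClassGroup (F : Type) →ₜ* Circle)
      (hμ : IdeleClassGroup.IsConjugateSymplectic (F : Type) μ) (hw : IdeleClassGroup.HasWeight (F : Type) μ 1),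
      Nonempty ((toThm418Data _ (restOfCharDeltaPrime (Summit.HodgeConjecture.CorCM.DelRec.exists_recordSystem_of_printed hDel) ⟨HodgeCM.CMField.K F⟩ h6 ι₁ ⟨HodgeCM.HermSpace3.Hm V, HodgeCM.HermSpace3.isHermitian V, HodgeCM.HermSpace3.signature_ι₁ V, HodgeCM.HermSpace3.posDef_of_ne V⟩ Φ e₁ (frameD V) (frameD_real V) (frameD_ne V) (ιVE V) (Rep.update ↥(maximalRealSubfield (HodgeCM.CMField.K F)) (imagUnitSq (HodgeCM.CMField.K F)) (Rep.ofLineOf ↥(maximalRealSubfield (HodgeCM.CMField.K F)) (imagUnitSq (HodgeCM.CMField.K F))) (locF ↥(maximalRealSubfield (HodgeCM.CMField.K F)) (imagUnitSq (HodgeCM.CMField.K F)) (realUnit ⟨HodgeCM.CMField.K F⟩ a.1 a.2.1 a.2.2)) (realUnit ⟨HodgeCM.CMField.K F⟩ a.1 a.2.1 a.2.2) rfl) μ hμ hw)).AdmIndex)) ∧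
    (∀ (hDel : Literature.AlgebraicGeometry.ShimuraVarieties.UnitaryCanonicalModel.canonicalModel_exists_printed) (a : RealScalar F)
      (Φ : CMType F), Nonempty (((μw : {μ : Literature.NumberTheory.Automorphic.IdeleClassGroup (F : Type) →ₜ* Circle // IdeleClassGroup.IsConjugateSymplectic (F : Type) μ ∧ IdeleClassGroup.HasWeight (F : Type) μ 1}) × (toThm418Data _ (restOfCharDeltaPrime (Summit.HodgeConjecture.CorCM.DelRec.exists_recordSystem_of_printed hDel) ⟨HodgeCM.CMField.K F⟩ h6 ι₁ ⟨HodgeCM.HermSpace3.Hm V, HodgeCM.HermSpace3.isHermitian V, HodgeCM.HermSpace3.signature_ι₁ V, HodgeCM.HermSpace3.posDef_of_ne V⟩ Φ e₁ (frameD V) (frameD_real V) (frameD_ne V) (ιVE V) (Rep.update ↥(maximalRealSubfield (HodgeCM.CMField.K F)) (imagUnitSq (HodgeCM.CMField.K F)) (Rep.ofLineOf ↥(maximalRealSubfield (HodgeCM.CMField.K F)) (imagUnitSq (HodgeCM.CMField.K F))) (locF ↥(maximalRealSubfield (HodgeCM.CMField.K F)) (imagUnitSq (HodgeCM.CMField.K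 F)) (realUnit ⟨HodgeCM.CMField.K F⟩ a.1 a.2.1 a.2.2)) (realUnit ⟨HodgeCM.CMField.K F⟩ a.1 a.2.1 a.2.2) rfl) μw.1 μw.2.1 μw.2.2)).AdmIndex))) ∧
    Nonempty (IsDedekindDomain.HeightOneSpectrum (𝓞 ↥(maximalRealSubfield (F : Type)))) :=
  ⟨hypLiu418_telescope_inhabited_of_head F h6 V, fun a₀ => hyp413_tail_inhabited F hemb V a₀, hyp411_tail_inhabited F ι₁,
    fun hDel a Φ μ hμ hw => hypD1pp_index_inhabited hDel F h6 V a Φ μ hμ hw, fun hDel a Φ => hypD3_index_inhabited hDel F h6 V a Φ,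
    nonempty_heightOneSpectrum_maximalRealSubfield F⟩

end NonvacuityBinderTails

end Summit.HodgeConjecture.CorCM.D2Bridge.MuKeyIdentLemD3DelRecConjOmegaEndT

end
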